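import Literature.NumberTheory.EllipticCurves.ZpExtensionEisensteinPinnedSelmerGlueProofs
import Literature.NumberTheory.EllipticCurves.ZpExtensionEisensteinTowerDivisionProofs
import Literature.NumberTheory.EllipticCurves.IwasawaAlgebraEisensteinTwistedInvariantsReadout
import Literature.Algebra.Homology.DiscreteRepGaloisCorollaries
import HarnessLib

/-!
# The pinned `H¹(K, T_𝔮)` is `S_𝔮`-TORSION-FREE when `H⁰(K, T_𝔮/pT_𝔮) = 0` (for the curve: `E(K)[p] = 0`):
# `H⁰(K, M ⊗ A_{m,1}(ψ)) = 0`, injectivity of `H¹(×p) : H¹(K, T_𝔮/p^k) → H¹(K, T_𝔮/p^{k+1})`, and the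
# NON-VANISHING of a control value without Theorem 1.6.1 (proofs file)

Topic `NumberTheory/EllipticCurves`. THEOREMS ONLY (no definition, no named fact, no instance, no notation, no
`sorry`). Sequel of `ZpExtensionEisensteinPinnedSelmerGlueProofs` (the pin `I : ZpExtension.EisensteinH1Data κ ρ t hm` of
Howard's `H¹(K, T_𝔮) = lim_k H¹(K, T_𝔮/p^k T_𝔮)`, `𝔮 = (T^m + p)`, as an honest `S_m = Λ/(q_m)`-module; the cokernel
bound and `apply_ne_zero_of_smul_mem_span`, which needed Thm. 1.6.1 (a)), of `ZpExtensionEisensteinTowerDivisionProofs`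
(x9-p1-w3: the two-index family `eisensteinTwistTransfer … a b : W_a →ⁱL W_b`, `W_k = M_k ⊗ A_{m,k}(ψ) = T_𝔮/p^k`, with
the short exact sequences `0 → W_ℓ →(×p^n) W_{ℓ+n} → W_n → 0`), of `IwasawaAlgebraEisensteinTwistedInvariantsReadout`
(x10b-p2: coordinates `w_i = λ([π_i^*] • y)` of `A_{m,k} ⊗ H`, `[T]` shifts them) and of the long exact sequence of
Galois cohomology `Literature.Algebra.Homology.DiscreteRep.galoisCohomology_exact₁` (`DiscreteRepGaloisCorollaries`).

WHAT (cell `pub/bsd-print-x9`, seat `bsd-line-x10b-p1-w2` g9, (C8); for the μ-crux `MuInequalityCoherentPair(OfHoward)`,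
skeleton `Cruxes/MuInequalityCoherentPair/Lines/spec_witnesses.lean`).
* §1 `eisensteinTwist_one_eq_zero_of_X_smul_eq_zero`, **`eisensteinTwist_one_eq_zero_of_forall_apply_eq_self`**,
  `subsingleton_galoisCohomology_eisensteinTwist_one_zero` — **`H⁰(K, M ⊗ A_{m,1}(ψ)) = 0`** whenever `pM = 0` and
  `H⁰(K, M) = 0` (for `M = E[p]`: `H⁰(K, T_𝔮/pT_𝔮) = 0` from `E(K)[p] = 0`): an invariant `y` has `[T]^m y = -p y = 0`;
  peel off powers of the equivariant nilpotent `[T]`; an invariant killed by `[T]` is `[T^{m-1}] ⊗ w` (coordinates) on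
  which `σ` acts through `ρ(σ)` alone (`(1+T)^e [T^{m-1}] = [T^{m-1}]` in `A_{m,1} = 𝔽_p[T]/(T^m)`), so `w ∈ H⁰(K, M) = 0`.
* §2 `map_eisensteinTwistTransfer_succ_injective` — **`H¹(×p) : H¹(K, T_𝔮/p^k) → H¹(K, T_𝔮/p^{k+1})` is injective**
  (long exact sequence of `0 → T_𝔮/p^k → T_𝔮/p^{k+1} → T_𝔮/p → 0` at `H⁰(T_𝔮/p) → H¹ → H¹`);
  `map_transfer_map_transfer_eq_map_smulHom` — `H¹(×p) ∘ H¹(red) = H¹([p]•)` (cocycle level).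
* §3 for ANY pin `I` (generic exact tower `(M_k, t_k)` with `ℤ/p^k`-bases, `H⁰(K, M_1) = 0`):
  **`EisensteinH1Data.eq_zero_of_natCast_smul_eq_zero`** (`p • h = 0 ⇒ h = 0`), `eq_zero_of_X_smul_eq_zero`
  (`π = T`: `T^m + p` kills `I.H`), `eq_zero_of_X_pow_smul_eq_zero`, **`eq_zero_of_smul_eq_zero_of_mk_ne_zero`** (`g • h = 0`
  with `[g] ≠ 0 ∈ S_𝔮` ⇒ `h = 0`: `S_𝔮` a DVR with uniformiser `π`), and
  **`apply_ne_zero_of_not_mem_of_smul_mem_span`** — for `f : 𝔖 → H¹(K, T_𝔮)` `Λ`-linear, `f x ∉ T^j • H¹(K, T_𝔮)` and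
  `g • x ∈ Λz` with `[g] ≠ 0`: **`f z ≠ 0`** — WITHOUT the free-rank-one conclusion of Thm. 1.6.1 (compare
  `IwasawaAlgebra.apply_ne_zero_of_smul_mem_span` of the prequel, which needed it). With the tree's
  `PrintX10bModPDivision.exists_forall_toEisensteinH1Linear_not_mem_X_pow_smul_top` (ONE `e`, ONE `n₁`, all `m ≥ p^{n₁}`) and
  `IwasawaAlgebra.exists_forall_mk_ne_zero` this makes the bottom class `f_m z` of the Kolyvagin system pushed to the
  Eisenstein DVR setting NON-ZERO for every `m ≫ 0` — the hypothesis `κ₁ ≠ 0` of Howard's Theorem 1.6.1 (the conjunct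
  `κKS.one ≠ 0` of `stub_howardInputs`) — replacing the finite-KERNEL route
  (`IwasawaAlgebraSpecializationFiniteKernelSeparationProofs`, which needs the kernel half of the control theorem, not
  in the tree). The curve is the Summits-side companion `Theorems/PrintX10bControlBottomClassNonvanishing`.

WHY IT IS HOWARD'S ARGUMENT. Proof of Thm. 2.2.10 (arXiv 3.2.10, p. 17 L90–92): «It follows from Proposition (control)
and Lemma (torsion free) that `κ₁^{(𝔭)}` generates an infinite `S_𝔭`-submodule of `H¹_{F_𝔭}(K, T_𝔭)` for all but finitely
many height-one primes», Lemma 2.2.9 (arXiv 3.2.9) being torsion-freeness «by [Perrin-Riou] 1.3.3 and the fact that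
`E(K_∞)[p] = 0`». Here the torsion-freeness is proved AFTER specialisation at `𝔮 = q_m` (from `E(K)[p] = 0` through
`H⁰(K, T_𝔮/p) = 0`), which is what makes the kernel of the control map irrelevant for `κ₁^{(𝔮)} ≠ 0`. HONEST FRAMING:
no control theorem, no Kolyvagin system and nothing about `L`-functions is proved here; BSD is not proved by any of this; no
summit statement is proved by this seat.

References: [Howard2004HeegnerKolyvagin] B. Howard, *The Heegner point Kolyvagin system*, Compositio Math. 140 (2004) =
arXiv:1202.6340: §2.2 Def. 2.2.3, Lemma 2.2.9 (arXiv 3.2.9, p. 17 L60–66), proof of Thm. 2.2.10 (arXiv 3.2.10, p. 17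
L82–92: «taking 𝔮 = T^m + p»; κ₁^{(𝔭)} ≠ 0 for almost all 𝔭), Def. 1.1.3 (Quot(T)); [GreenbergLNM1716] R. Greenberg,
LNM 1716 (1999), §4 p. 109 (`E(F_∞)[p] = 0` when `E(F)[p] = 0`); [Harari2020] D. Harari, *Galois Cohomology and Class Field
Theory*, Thm. 1.17 (long exact sequence); [SerreGaloisCohomology1997] I §2.2 (H⁰ = invariants, H¹ on cocycles);
[SerreLocalFields1979] I §6 (DVRs); [Washington1997] §13.2 (`Λ/(p, T^m)`).
-/

set_option autoImplicit false

noncomputable section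

open scoped TensorProduct ContRepresentation Classical
open Field IsLocalRing

namespace Literature.NumberTheory.EllipticCurves

open Literature.NumberTheory.GaloisRepresentations
open Literature.NumberTheory.GaloisCohomology.Howard2004
open Literature.Algebra.Homology.DiscreteRep

namespace ZpExtension

/-! ## §1 `H⁰(K, M ⊗ A_{m,1}(ψ)) = 0` when `M` is killed by `p` and `H⁰(K, M) = 0` -/

section HZero

variable {K : Type} [Field K] {p : ℕ} [hp : Fact p.Prime] (κ : ZpExtension K p)
  {M₁ : Type} [AddCommGroup M₁] [TopologicalSpace M₁] [DiscreteTopology M₁] (ρ₁ : DiscreteGaloisModule K M₁)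
  {m : ℕ} (hm : 1 ≤ m)

include hm in
/-- In `A_{m,1} = Λ/(q_m, p) = 𝔽_p[T]/(T^m)`: `(1+T) · [T^{m-1}] = [T^{m-1}]` (`[T^m] = -p = 0`).
[cite: Washington1997, §13.2] [cite: Howard2004HeegnerKolyvagin, proof of Thm. 2.2.10 (𝔮 = T^m + p)] -/
theorem onePlusT_mul_mk_X_pow_pred_one :
    IwasawaAlgebra.EisensteinCoeff.onePlusT p m 1 *
        (Ideal.Quotient.mk _ ((PowerSeries.X : IwasawaAlgebra p) ^ (m - 1)) : IwasawaAlgebra.EisensteinCoeff p m 1) =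
      Ideal.Quotient.mk _ ((PowerSeries.X : IwasawaAlgebra p) ^ (m - 1)) := by
  have hpow : (PowerSeries.X : IwasawaAlgebra p) * PowerSeries.X ^ (m - 1) = PowerSeries.X ^ m := by
    rw [← pow_succ', Nat.sub_add_cancel hm]
  rw [IwasawaAlgebra.EisensteinCoeff.onePlusT_def, ← map_mul, add_mul, one_mul, hpow, map_add,
    IwasawaAlgebra.EisensteinCoeff.mk_X_pow_eq_neg_natCast p 1]
  have h0 : (p : IwasawaAlgebra.EisensteinCoeff p m 1) = 0 := by
    simpa only [pow_one] using IwasawaAlgebra.natCast_pow_eq_zero_quotient p m 1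
  rw [h0, neg_zero, add_zero]

include hm in
/-- Hence `(1+T)^e · [T^{m-1}] = [T^{m-1}]` in `A_{m,1}` for every `e`. [cite: Washington1997, §13.2] -/
theorem onePlusT_pow_mul_mk_X_pow_pred_one (e : ℕ) :
    IwasawaAlgebra.EisensteinCoeff.onePlusT p m 1 ^ e *
        (Ideal.Quotient.mk _ ((PowerSeries.X : IwasawaAlgebra p) ^ (m - 1)) : IwasawaAlgebra.EisensteinCoeff p m 1) =
      Ideal.Quotient.mk _ ((PowerSeries.X : IwasawaAlgebra p) ^ (m - 1)) := by
  induction e with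
  | zero => rw [pow_zero, one_mul]
  | succ e ih => rw [pow_succ (IwasawaAlgebra.EisensteinCoeff.onePlusT p m 1) e, mul_assoc,
      onePlusT_mul_mk_X_pow_pred_one (p := p) hm, ih]

/-- **An invariant of `M ⊗ A_{m,1}(ψ)` killed by `[T]` is zero** when `M` is killed by `p` and `H⁰(K, M) = 0`:
such an element has all coordinates `w_i`, `i ≤ m-2`, equal to `0` (`[T]` shifts coordinates), so it is
`[T^{m-1}] ⊗ w` on which `σ` acts by `[T^{m-1}] ⊗ ρ(σ) w` (`(1+T)^e [T^{m-1}] = [T^{m-1}]`); invariance forces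
`w ∈ H⁰(K, M) = 0`. [cite: Howard2004HeegnerKolyvagin, §2.2 and proof of Thm. 2.2.10 (T_𝔮/𝔪 T_𝔮 = E[p])]
[cite: GreenbergLNM1716, §4 p. 109 (E(F_∞)[p] = 0 when E(F)[p] = 0)] -/
theorem eisensteinTwist_one_eq_zero_of_X_smul_eq_zero (hM : ∀ a : M₁, p ^ 1 • a = 0)
    (hinv : ∀ a : M₁, (∀ σ : absoluteGaloisGroup K, ρ₁ σ a = a) → a = 0)
    (z : IwasawaAlgebra.EisensteinCoeff.Twisted p m 1 M₁)
    (hz : ∀ σ : absoluteGaloisGroup K, κ.eisensteinTwist ρ₁ hm 1 σ z = z)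
    (hX : (Ideal.Quotient.mk _ (PowerSeries.X : IwasawaAlgebra p) : IwasawaAlgebra.EisensteinCoeff p m 1) • z = 0) :
    z = 0 := by
  -- coordinates `w i` of `z`
  set w : Fin m → M₁ := fun i ↦ IwasawaAlgebra.EisensteinCoeff.Twisted.tailReadout p hm 1 hM
    (IwasawaAlgebra.EisensteinCoeff.dualFamily p hm 1 i • z) with hw
  have hzw : z = ∑ i : Fin m, IwasawaAlgebra.EisensteinCoeff.Twisted.tmul
      (Ideal.Quotient.mk _ ((PowerSeries.X : IwasawaAlgebra p) ^ (i : ℕ)) : IwasawaAlgebra.EisensteinCoeff p m 1) (w i) :=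
    IwasawaAlgebra.EisensteinCoeff.Twisted.eq_sum_tmul_tailReadout p hm 1 hM z
  -- all coordinates below the top vanish
  have hlow : ∀ i : Fin m, (i : ℕ) + 1 < m → w i = 0 := by
    intro i hi
    have h := IwasawaAlgebra.EisensteinCoeff.Twisted.tailReadout_dualFamily_smul_X_smul_sum p hm 1 hM w ⟨(i : ℕ) + 1, hi⟩
    rw [← hzw, hX, smul_zero, map_zero] at h
    have hne : ¬ (((⟨(i : ℕ) + 1, hi⟩ : Fin m) : ℕ) = 0) := Nat.succ_ne_zero _
    rw [if_neg hne] at h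
    have hidx : (⟨((⟨(i : ℕ) + 1, hi⟩ : Fin m) : ℕ) - 1, lt_of_le_of_lt (Nat.sub_le _ _) hi⟩ : Fin m) = i :=
      Fin.ext (by simp)
    rw [hidx] at h
    exact h.symm
  -- so `z = [T^{m-1}] ⊗ w_{m-1}`
  set top : Fin m := ⟨m - 1, Nat.sub_lt (lt_of_lt_of_le zero_lt_one hm) zero_lt_one⟩ with htop
  have hztop : z = IwasawaAlgebra.EisensteinCoeff.Twisted.tmul
      (Ideal.Quotient.mk _ ((PowerSeries.X : IwasawaAlgebra p) ^ (m - 1)) : IwasawaAlgebra.EisensteinCoeff p m 1)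
      (w top) := by
    rw [hzw, Finset.sum_eq_single top]
    · intro i _ hi
      have hi' : (i : ℕ) + 1 < m := by
        have h1 : (i : ℕ) ≠ m - 1 := fun h ↦ hi (Fin.ext (by rw [h]))
        have h2 := i.2
        omega
      rw [hlow i hi', IwasawaAlgebra.EisensteinCoeff.Twisted.tmul_zero]
    · intro h; exact absurd (Finset.mem_univ _) h
  -- invariance of `z` forces invariance of `w_{m-1}`
  have hwinv : ∀ σ : absoluteGaloisGroup K, ρ₁ σ (w top) = w top := by
    intro σ
    have h := hz σ
    rw [hztop, κ.eisensteinTwist_apply_tmul ρ₁ hm 1 σ, onePlusT_pow_mul_mk_X_pow_pred_one (p := p) hm] at h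
    -- read both sides with the tail form
    have hread : ∀ a : M₁, IwasawaAlgebra.EisensteinCoeff.Twisted.tailReadout p hm 1 hM
        (IwasawaAlgebra.EisensteinCoeff.Twisted.tmul
          (Ideal.Quotient.mk _ ((PowerSeries.X : IwasawaAlgebra p) ^ (m - 1)) : IwasawaAlgebra.EisensteinCoeff p m 1) a) =
        a := by
      intro a
      have hs := IwasawaAlgebra.EisensteinCoeff.Twisted.tailReadout_sum p hm 1 hM (fun i ↦ if i = top then a else 0)
      rw [Finset.sum_eq_single top] at hs
      · simpa [htop] using hs
      · intro i _ hi
        rw [if_neg hi, IwasawaAlgebra.EisensteinCoeff.Twisted.tmul_zero]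
      · intro h'; exact absurd (Finset.mem_univ _) h'
    have h' := congrArg (IwasawaAlgebra.EisensteinCoeff.Twisted.tailReadout p hm 1 hM) h
    rwa [hread, hread] at h'
  have hw0 : w top = 0 := hinv _ hwinv
  rw [hztop, hw0, IwasawaAlgebra.EisensteinCoeff.Twisted.tmul_zero]

/-- **`H⁰(K, M ⊗ A_{m,1}(ψ)) = 0` (module form)**: an element of `M ⊗ A_{m,1}(ψ)` fixed by `Γ_K` is `0`, when `M` is
killed by `p` and `H⁰(K, M) = 0` — by descending induction along `[T]^n • y` (`[T]` acts nilpotently and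
equivariantly). For `M = E[p]`: `H⁰(K, T_𝔮/pT_𝔮) = 0` from `E(K)[p] = 0`.
[cite: Howard2004HeegnerKolyvagin, §2.2 and proof of Thm. 2.2.10] [cite: GreenbergLNM1716, §4 p. 109] -/
theorem eisensteinTwist_one_eq_zero_of_forall_apply_eq_self (hM : ∀ a : M₁, p ^ 1 • a = 0)
    (hinv : ∀ a : M₁, (∀ σ : absoluteGaloisGroup K, ρ₁ σ a = a) → a = 0)
    (y : IwasawaAlgebra.EisensteinCoeff.Twisted p m 1 M₁)
    (hy : ∀ σ : absoluteGaloisGroup K, κ.eisensteinTwist ρ₁ hm 1 σ y = y) : y = 0 := by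
  -- `[T]^n • y = 0 → y = 0` for invariant `y`, by induction on `n`
  have key : ∀ (n : ℕ) (y : IwasawaAlgebra.EisensteinCoeff.Twisted p m 1 M₁),
      (∀ σ : absoluteGaloisGroup K, κ.eisensteinTwist ρ₁ hm 1 σ y = y) →
      (Ideal.Quotient.mk _ (PowerSeries.X : IwasawaAlgebra p) : IwasawaAlgebra.EisensteinCoeff p m 1) ^ n • y = 0 →
        y = 0 := by
    intro n
    induction n with
    | zero => intro y _ h; rwa [pow_zero, one_smul] at h
    | succ n ih =>
      intro y hy h
      rw [pow_succ' (Ideal.Quotient.mk _ (PowerSeries.X : IwasawaAlgebra p) : IwasawaAlgebra.EisensteinCoeff p m 1) n,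
        mul_smul] at h
      have hinv' : ∀ σ : absoluteGaloisGroup K, κ.eisensteinTwist ρ₁ hm 1 σ
          ((Ideal.Quotient.mk _ (PowerSeries.X : IwasawaAlgebra p) : IwasawaAlgebra.EisensteinCoeff p m 1) ^ n • y) =
          (Ideal.Quotient.mk _ (PowerSeries.X : IwasawaAlgebra p) : IwasawaAlgebra.EisensteinCoeff p m 1) ^ n • y :=
        fun σ ↦ by rw [κ.eisensteinTwist_apply_smul ρ₁ hm 1 σ, hy σ]
      have h0 := κ.eisensteinTwist_one_eq_zero_of_X_smul_eq_zero ρ₁ hm hM hinv _ hinv' h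
      exact ih y hy h0
  refine key m y hy ?_
  have h0 : (p : IwasawaAlgebra.EisensteinCoeff p m 1) = 0 := by
    simpa only [pow_one] using IwasawaAlgebra.natCast_pow_eq_zero_quotient p m 1
  rw [← map_pow, IwasawaAlgebra.EisensteinCoeff.mk_X_pow_eq_neg_natCast p 1, h0, neg_zero, zero_smul]

/-- **`H⁰(K, M ⊗ A_{m,1}(ψ))` is trivial** (`galoisCohomology … 0` is a subsingleton) when `M` is killed by `p` and
`H⁰(K, M) = 0`. [cite: Howard2004HeegnerKolyvagin, §2.2 and proof of Thm. 2.2.10] [cite: SerreGaloisCohomology1997, I §2.2 (H⁰ = invariants)] -/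
theorem subsingleton_galoisCohomology_eisensteinTwist_one_zero (hM : ∀ a : M₁, p ^ 1 • a = 0)
    (hinv : ∀ a : M₁, (∀ σ : absoluteGaloisGroup K, ρ₁ σ a = a) → a = 0) :
    Subsingleton (galoisCohomology (κ.eisensteinTwist ρ₁ hm 1) 0) := by
  refine ⟨fun a b ↦ ?_⟩
  have hzero : ∀ c : galoisCohomology (κ.eisensteinTwist ρ₁ hm 1) 0, c = 0 := by
    intro c
    apply (galoisCohomologyZeroEquiv (κ.eisensteinTwist ρ₁ hm 1)).injective
    rw [map_zero]
    apply Subtype.ext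
    have hmem := (ContinuousRep.mem_invariants _ _).1 (galoisCohomologyZeroEquiv (κ.eisensteinTwist ρ₁ hm 1) c).2
    exact κ.eisensteinTwist_one_eq_zero_of_forall_apply_eq_self ρ₁ hm hM hinv _ fun σ ↦ hmem σ
  rw [hzero a, hzero b]

end HZero

/-! ## §2 `H¹(×p) : H¹(K, T_𝔮/p^k) → H¹(K, T_𝔮/p^{k+1})` is injective -/

section Transfer

variable {K : Type} [Field K] [CharZero K] {p : ℕ} [hp : Fact p.Prime] (κ : ZpExtension K p)
  {M : ℕ → Type} [∀ k, AddCommGroup (M k)] [∀ k, TopologicalSpace (M k)] [∀ k, DiscreteTopology (M k)]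
  (ρ : ∀ k, DiscreteGaloisModule K (M k))
  (t : ∀ k, (ρ (k + 1)).toContRepresentation →ⁱL (ρ k).toContRepresentation) {m : ℕ} (hm : 1 ≤ m)
  (ht : ∀ k, Function.Surjective (t k))
  (hkt : ∀ k (x : M (k + 1)), t k x = 0 ↔ ∃ y : M (k + 1), x = ((p : ℤ) ^ k) • y)
  (hkill : ∀ k (x : M k), ((p : ℤ) ^ k) • x = 0)
  {ι : ℕ → Type} [∀ k, Fintype (ι k)] (e : ∀ k, M k ≃+ (ι k → ZMod (p ^ k)))

omit [CharZero K] in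
/-- `H¹(f)[φ] = [f ∘ φ]` for an equivariant continuous `f` between discrete Galois modules (the tree's
`map_oneCocycleClass` along the identity of `Γ_K`). [cite: SerreGaloisCohomology1997, I §2.2] -/
theorem map_oneCocycleClass_id {N N' : Type} [AddCommGroup N] [TopologicalSpace N] [DiscreteTopology N]
    [AddCommGroup N'] [TopologicalSpace N'] [DiscreteTopology N'] {τ : DiscreteGaloisModule K N}
    {τ' : DiscreteGaloisModule K N'} (f : τ.toContRepresentation →ⁱL τ'.toContRepresentation)
    (φ : contOneCocycles τ.toTopRep) :
    galoisCohomology.map f 1 (oneCocycleClass τ.toTopRep φ) =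
      oneCocycleClass τ'.toTopRep (contOneCocycles.pullback (ContinuousMonoidHom.id (absoluteGaloisGroup K))
        (X := τ.toTopRep) (Y := τ'.toTopRep) (TopRep.ofHom ⟨f.toContinuousLinearMap, f.isIntertwining'⟩) φ) :=
  map_oneCocycleClass _ _ _ φ

include e in
/-- **`H¹(×p)` is injective on the Eisenstein tower**: for `H⁰(K, M_1) = 0`, the map
`H¹(K, T_𝔮/p^k) → H¹(K, T_𝔮/p^{k+1})` induced by the division `×p : T_𝔮/p^k ↪ T_𝔮/p^{k+1}`
(`eisensteinTwistTransfer … k (k+1)`) is injective — the long exact sequence of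
`0 → T_𝔮/p^k → T_𝔮/p^{k+1} → T_𝔮/p → 0` and `H⁰(K, T_𝔮/p) = 0` (§1).
[cite: Howard2004HeegnerKolyvagin, §2.2 and proof of Thm. 2.2.10] [cite: Harari2020, Theorem 1.17] -/
theorem map_eisensteinTwistTransfer_succ_injective
    (hinv : ∀ a : M 1, (∀ σ : absoluteGaloisGroup K, ρ 1 σ a = a) → a = 0) (k : ℕ) :
    Function.Injective (galoisCohomology.map (κ.eisensteinTwistTransfer ρ t hm ht hkt hkill k (k + 1)) 1) := by
  have hM1 : ∀ a : M 1, p ^ 1 • a = 0 := fun a ↦ by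
    have := hkill 1 a
    rwa [← Nat.cast_smul_eq_nsmul ℤ, Nat.cast_pow]
  haveI := κ.subsingleton_galoisCohomology_eisensteinTwist_one_zero (ρ 1) hm hM1 hinv
  -- the short exact sequence `0 → W_k → W_{k+1} → W_1 → 0`
  have hf : Function.Injective (κ.eisensteinTwistTransfer ρ t hm ht hkt hkill k (k + 1)) :=
    κ.eisensteinTwistTransfer_injective_of_le ρ t hm ht hkt hkill e k 1
  have hg : Function.Surjective (κ.eisensteinTwistTransfer ρ t hm ht hkt hkill (k + 1) 1) :=
    κ.eisensteinTwistTransfer_surjective_of_le ρ t hm ht hkt hkill (Nat.le_add_left 1 k)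
  have hex : ∀ y, κ.eisensteinTwistTransfer ρ t hm ht hkt hkill (k + 1) 1 y = 0 →
      ∃ x, κ.eisensteinTwistTransfer ρ t hm ht hkt hkill k (k + 1) x = y :=
    fun y hy ↦ (κ.eisensteinTwistTransfer_eq_zero_iff_exists ρ t hm ht hkt hkill k 1 y).1 hy
  have hfg : ∀ x, κ.eisensteinTwistTransfer ρ t hm ht hkt hkill (k + 1) 1
      (κ.eisensteinTwistTransfer ρ t hm ht hkt hkill k (k + 1) x) = 0 :=
    fun x ↦ (κ.eisensteinTwistTransfer_eq_zero_iff_exists ρ t hm ht hkt hkill k 1 _).2 ⟨x, rfl⟩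
  have hexact := galoisCohomology_exact₁ (κ.eisensteinTwist (ρ k) hm k) (κ.eisensteinTwist (ρ (k + 1)) hm (k + 1))
    (κ.eisensteinTwist (ρ 1) hm 1) (κ.eisensteinTwistTransfer ρ t hm ht hkt hkill k (k + 1))
    (κ.eisensteinTwistTransfer ρ t hm ht hkt hkill (k + 1) 1) hfg hf hg hex 0
  rw [injective_iff_map_eq_zero]
  intro y hy
  obtain ⟨c, hc⟩ := (hexact y).1 hy
  rw [← hc, Subsingleton.elim c 0, map_zero]

omit [CharZero K] in
/-- **`H¹(×p) ∘ H¹(red) = H¹([p] •)`** on `H¹(K, T_𝔮/p^{k+1})`: reducing to `T_𝔮/p^k` and dividing back is the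
coefficient action of `[p] ∈ A_{m,k+1}` (`eisensteinTwistTransfer_apply_apply_of_le`), read on cocycle classes.
[cite: Howard2004HeegnerKolyvagin, Def. 1.1.3 and §2.2] -/
theorem map_transfer_map_transfer_eq_map_smulHom (k : ℕ)
    (x : galoisCohomology (κ.eisensteinTwist (ρ (k + 1)) hm (k + 1)) 1) :
    galoisCohomology.map (κ.eisensteinTwistTransfer ρ t hm ht hkt hkill k (k + 1)) 1
        (galoisCohomology.map (κ.eisensteinTwistTransfer ρ t hm ht hkt hkill (k + 1) k) 1 x) =
      galoisCohomology.map (κ.eisensteinTwistSMulHom (ρ (k + 1)) hm (k + 1)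
        (Ideal.Quotient.mk _ (p : IwasawaAlgebra p))) 1 x := by
  obtain ⟨φ, rfl⟩ := oneCocycleClass_surjective _ x
  rw [map_oneCocycleClass_id, map_oneCocycleClass_id, map_oneCocycleClass_id]
  congr 1
  refine Subtype.ext (ContinuousMap.ext fun σ ↦ ?_)
  change κ.eisensteinTwistTransfer ρ t hm ht hkt hkill k (k + 1)
      (κ.eisensteinTwistTransfer ρ t hm ht hkt hkill (k + 1) k (φ.1 σ)) =
    κ.eisensteinTwistSMulHom (ρ (k + 1)) hm (k + 1) (Ideal.Quotient.mk _ (p : IwasawaAlgebra p)) (φ.1 σ)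
  have hmk : (Ideal.Quotient.mk _ (p : IwasawaAlgebra p) : IwasawaAlgebra.EisensteinCoeff p m (k + 1)) = p :=
    map_natCast _ p
  rw [κ.eisensteinTwistTransfer_apply_apply_of_le ρ t hm ht hkt hkill k 1, pow_one, eisensteinTwistSMulHom_mk_apply,
    hmk, Nat.cast_smul_eq_nsmul]

end Transfer

/-! ## §3 The pinned `H¹(K, T_𝔮)` has no `p`-torsion, hence no `S_𝔮`-torsion -/

namespace EisensteinH1Data

section TorsionFree

variable {K : Type} [Field K] [CharZero K] {p : ℕ} [hp : Fact p.Prime] {κ : ZpExtension K p}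
  {M : ℕ → Type} [∀ k, AddCommGroup (M k)] [∀ k, TopologicalSpace (M k)] [∀ k, DiscreteTopology (M k)]
  {ρ : ∀ k, DiscreteGaloisModule K (M k)}
  {t : ∀ k, (ρ (k + 1)).toContRepresentation →ⁱL (ρ k).toContRepresentation} {m : ℕ} {hm : 1 ≤ m}
  (I : EisensteinH1Data κ ρ t hm)
  (ht : ∀ k, Function.Surjective (t k))
  (hkt : ∀ k (x : M (k + 1)), t k x = 0 ↔ ∃ y : M (k + 1), x = ((p : ℤ) ^ k) • y)
  (hkill : ∀ k (x : M k), ((p : ℤ) ^ k) • x = 0)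
  {ι : ℕ → Type} [∀ k, Fintype (ι k)] (e : ∀ k, M k ≃+ (ι k → ZMod (p ^ k)))
  (hinv : ∀ a : M 1, (∀ σ : absoluteGaloisGroup K, ρ 1 σ a = a) → a = 0)

include ht hkt hkill e hinv

/-- **The pinned `H¹(K, T_𝔮)` has no `p`-torsion** when `H⁰(K, T_𝔮/p) = 0`: if `p • h = 0` then every
`H¹(×p)(proj_k h) = p • proj_{k+1} h = 0`, so `proj_k h = 0` by injectivity of `H¹(×p)`.
[cite: Howard2004HeegnerKolyvagin, §2.2 and proof of Thm. 2.2.10] [cite: GreenbergLNM1716, §4 p. 109] -/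
theorem eq_zero_of_natCast_smul_eq_zero (h : I.H) (hh : (p : IwasawaAlgebra p) • h = 0) : h = 0 := by
  refine I.ext h fun k ↦ ?_
  apply κ.map_eisensteinTwistTransfer_succ_injective ρ t hm ht hkt hkill e hinv k
  rw [map_zero]
  have hred : galoisCohomology.map (κ.eisensteinTwistTransfer ρ t hm ht hkt hkill (k + 1) k) 1 (I.proj (k + 1) h) =
      I.proj k h := by
    rw [κ.eisensteinTwistTransfer_succ_self ρ t hm ht hkt hkill k]
    exact I.proj_reduce k h
  rw [← hred, κ.map_transfer_map_transfer_eq_map_smulHom ρ t hm ht hkt hkill k, ← I.proj_smul, hh, map_zero]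

/-- The same with the integer multiple: `p • h = 0 ⇒ h = 0`. [cite: Howard2004HeegnerKolyvagin, §2.2] -/
theorem eq_zero_of_nsmul_eq_zero (h : I.H) (hh : p • h = 0) : h = 0 :=
  I.eq_zero_of_natCast_smul_eq_zero ht hkt hkill e hinv h (by rwa [Nat.cast_smul_eq_nsmul])

/-- **No `π`-torsion**: `T • h = 0 ⇒ h = 0` (`π = T mod q_m` the uniformiser of `S_𝔮`; `T^m + p` kills `H¹(K, T_𝔮)`, so
`p • h = -T^{m-1} • (T • h) = 0`). [cite: Howard2004HeegnerKolyvagin, §2.2 (S_𝔮 a DVR with uniformiser π)] -/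
theorem eq_zero_of_X_smul_eq_zero (h : I.H) (hh : (PowerSeries.X : IwasawaAlgebra p) • h = 0) : h = 0 := by
  apply I.eq_zero_of_natCast_smul_eq_zero ht hkt hkill e hinv h
  have hq := I.qm_smul_eq_zero h
  rw [add_smul, map_natCast] at hq
  have hpow : (PowerSeries.X : IwasawaAlgebra p) ^ m = PowerSeries.X ^ (m - 1) * PowerSeries.X := by
    rw [← pow_succ, Nat.sub_add_cancel hm]
  have hX : ((PowerSeries.X : IwasawaAlgebra p) ^ m) • h = 0 := by
    rw [hpow, mul_smul, hh, smul_zero]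
  rwa [hX, zero_add] at hq

/-- `T^n • h = 0 ⇒ h = 0`. [cite: Howard2004HeegnerKolyvagin, §2.2] -/
theorem eq_zero_of_X_pow_smul_eq_zero (n : ℕ) (h : I.H) (hh : ((PowerSeries.X : IwasawaAlgebra p) ^ n) • h = 0) :
    h = 0 := by
  induction n generalizing h with
  | zero => rwa [pow_zero, one_smul] at hh
  | succ n ih =>
    rw [pow_succ, mul_smul] at hh
    exact I.eq_zero_of_X_smul_eq_zero ht hkt hkill e hinv h (ih _ hh)

end TorsionFree

section STorsionFree

variable {K : Type} [Field K] [CharZero K] {p : ℕ} [hp : Fact p.Prime] {κ : ZpExtension K p}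
  {M : ℕ → Type} [∀ k, AddCommGroup (M k)] [∀ k, TopologicalSpace (M k)] [∀ k, DiscreteTopology (M k)]
  {ρ : ∀ k, DiscreteGaloisModule K (M k)}
  {t : ∀ k, (ρ (k + 1)).toContRepresentation →ⁱL (ρ k).toContRepresentation} {m : ℕ} {hm : 1 ≤ m}
  (I : EisensteinH1Data κ ρ t hm)
  (ht : ∀ k, Function.Surjective (t k))
  (hkt : ∀ k (x : M (k + 1)), t k x = 0 ↔ ∃ y : M (k + 1), x = ((p : ℤ) ^ k) • y)
  (hkill : ∀ k (x : M k), ((p : ℤ) ^ k) • x = 0)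
  {ι : ℕ → Type} [∀ k, Fintype (ι k)] (e : ∀ k, M k ≃+ (ι k → ZMod (p ^ k)))
  (hinv : ∀ a : M 1, (∀ σ : absoluteGaloisGroup K, ρ 1 σ a = a) → a = 0)
  [IsDomain (IwasawaAlgebra p ⧸
    Ideal.span {(PowerSeries.X ^ m + PowerSeries.C (p : ℤ_[p]) : IwasawaAlgebra p)})]
  [IsDiscreteValuationRing (IwasawaAlgebra p ⧸
    Ideal.span {(PowerSeries.X ^ m + PowerSeries.C (p : ℤ_[p]) : IwasawaAlgebra p)})]

include ht hkt hkill e hinv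

/-- **The pinned `H¹(K, T_𝔮)` is `S_𝔮`-TORSION-FREE**: if `g • h = 0` with `q_m ∤ g` (`[g] ≠ 0` in the DVR
`S_𝔮 = Λ/(q_m)`), then `h = 0` — `[g]` is a unit times `π^n`, and there is no `π`-torsion.
[cite: Howard2004HeegnerKolyvagin, §2.2 (S_𝔮 a DVR) and proof of Thm. 2.2.10] [cite: SerreLocalFields1979, I §6] -/
theorem eq_zero_of_smul_eq_zero_of_mk_ne_zero (g : IwasawaAlgebra p)
    (hg : Ideal.Quotient.mk
      (Ideal.span {(PowerSeries.X ^ m + PowerSeries.C (p : ℤ_[p]) : IwasawaAlgebra p)}) g ≠ 0)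
    (h : I.H) (hh : g • h = 0) : h = 0 := by
  set π : IwasawaAlgebra p ⧸
      Ideal.span {(PowerSeries.X ^ m + PowerSeries.C (p : ℤ_[p]) : IwasawaAlgebra p)} :=
    Ideal.Quotient.mk _ PowerSeries.X with hπ
  have hirr : Irreducible π := by rw [hπ]; exact IwasawaAlgebra.irreducible_mk_X p hm
  obtain ⟨n, u, hu⟩ := IsDiscreteValuationRing.associated_pow_irreducible hg hirr
  -- `hu : [g] * u = π^n`; lift `u` to `s ∈ Λ`
  obtain ⟨s, hs⟩ := Ideal.Quotient.mk_surjective (u : IwasawaAlgebra p ⧸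
      Ideal.span {(PowerSeries.X ^ m + PowerSeries.C (p : ℤ_[p]) : IwasawaAlgebra p)})
  have hgs : (g * s) - PowerSeries.X ^ n ∈
      Ideal.span {(PowerSeries.X ^ m + PowerSeries.C (p : ℤ_[p]) : IwasawaAlgebra p)} := by
    rw [← Ideal.Quotient.eq, map_mul, hs, hu, hπ, map_pow]
  apply I.eq_zero_of_X_pow_smul_eq_zero ht hkt hkill e hinv n h
  rw [← I.smul_eq_smul_of_sub_mem_span_qm hgs h, mul_comm, mul_smul, hh, smul_zero]

/-- **Non-vanishing of a control value WITHOUT Theorem 1.6.1.** Let `f : 𝔖 → H¹(K, T_𝔮)` be `Λ`-linear into the pin,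
`e ∈ 𝔖` with `f e ∉ T^j • H¹(K, T_𝔮)`, and `g • e ∈ Λ z` with `[g] ≠ 0 ∈ S_𝔮`. Then `f z ≠ 0`: otherwise
`g • f e = λ • f z = 0`, so `f e = 0` by torsion-freeness. (For `𝔖/Λz` torsion: the bottom class `f_m z` of the
μ-crux is non-zero for every `m ≫ 0` — the input `κ.one ≠ 0` of Howard's theorem, no control KERNEL needed.)
[cite: Howard2004HeegnerKolyvagin, proof of Thm. 2.2.10 (κ₁^{(𝔭)} generates an infinite S_𝔭-submodule for almost all 𝔭)] -/
theorem apply_ne_zero_of_not_mem_of_smul_mem_span {S : Type*} [AddCommGroup S] [Module (IwasawaAlgebra p) S]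
    (f : S →ₗ[IwasawaAlgebra p] I.H) (x : S) {j : ℕ}
    (hx : f x ∉ (Ideal.span {(PowerSeries.X : IwasawaAlgebra p) ^ j} • ⊤ : Submodule (IwasawaAlgebra p) I.H))
    (z : S) (g : IwasawaAlgebra p)
    (hg : Ideal.Quotient.mk
      (Ideal.span {(PowerSeries.X ^ m + PowerSeries.C (p : ℤ_[p]) : IwasawaAlgebra p)}) g ≠ 0)
    (hgx : g • x ∈ (IwasawaAlgebra p) ∙ z) : f z ≠ 0 := by
  intro hz
  obtain ⟨l, hl⟩ := Submodule.mem_span_singleton.1 hgx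
  have h0 : g • f x = 0 := by rw [← map_smul, ← hl, map_smul, hz, smul_zero]
  have hx0 : f x = 0 := I.eq_zero_of_smul_eq_zero_of_mk_ne_zero ht hkt hkill e hinv g hg _ h0
  exact hx (hx0 ▸ zero_mem _)

end STorsionFree

end EisensteinH1Data

end ZpExtension

end Literature.NumberTheory.EllipticCurves

end
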